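import Literature.Algebra.EuclideanLattices.Problems
import Literature.Algebra.EuclideanLattices.UniqueSVPMultiples
import Literature.Algebra.EuclideanLattices.UniqueSVPBasisVector
import Literature.Algebra.EuclideanLattices.LatticeProblemsProofs
import HarnessLib

/-!
# Regev 2004, §3.2–3.3: the two-point structure of a measured register (Claims 3.5/3.13, 3.6/3.14)

Topic `Algebra/EuclideanLattices` (family `pqc`); proved material towards the discharge of the
named fact `Literature.Algebra.EuclideanLattices.usvp_of_dihedralCoset` (O. Regev, *Quantum
computation and lattice problems*, SIAM J. Comput. 33 (2004) 738–760, Thm. 1.1). No named fact is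
introduced; everything is proved.

Regev's routine (proofs of Lemmas 3.4 and 3.12) works with an integer basis `b₀, …, bₙ₋₁` whose
shortest vector is `ū = ∑ uᵢ bᵢ`, a modulus `p`, a residue `m` with `u_{i₀} ≡ m (mod p)` and
`1 ≤ m ≤ p − 1` (in the paper `p` is a prime and `i₀ = 1`; only the invertibility of `m` modulo `p`
is used, so that `p` may be a power of two and `m` odd), and the map
`f(t, ā) = (a_{i₀} p + t m) b_{i₀} + ∑_{i ≠ i₀} aᵢ bᵢ` on `{0,1} × ℤⁿ`. A register holds
`(t, ā)` together with a point `x̄` of a finite set `X ⊆ ℤⁿ` (in §3.3 the grid points of a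
ball), and the *measured* value is `y = f(t, ā) + x̄`. This file proves, over `ℤⁿ`:

* `twoPointCoeffs`, `twoPointVec` — the coefficient vector and the lattice point `f(t, ā)`;
  `hiddenShift` — `δ = ((u_{i₀} − m)/p at i₀, uᵢ elsewhere)`, the answer of the two-point
  problem; **`twoPointCoeffs_one_add_hiddenShift`** / **`twoPointVec_partner`**:
  `f(1, ā + δ) = f(0, ā) + ū`, so `(0, ā, x̄)` and `(1, ā + δ, x̄ − ū)` are measured alike;
* `twoPointCoeffs_injective` — `(t, ā) ↦ f(t, ā)` is injective on `{0,1} × ℤⁿ`;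
* `int_modEq_of_sub_eq_smul_of_isCoprime` — the `mod p` bookkeeping for `m` coprime to `p`
  (the prime case is `Regev2004.int_modEq_of_sub_eq_smul` of `UniqueSVPMultiples.lean`);
* **`fiber_unique_of_eq`**, **`fiber_pair`** — **Claim 3.13** (= Claim 3.5 with balls): if
  every difference of two points of `X` is shorter than `λ₂(L)` and than `(p − 1) λ₁(L)`, then
  for every measured value `y` there is at most one `(0, ā)` and at most one `(1, ā')` with
  `y − f(t, ā) ∈ X`, and if both occur then `ā' = ā + δ`;
* **Claim 3.14, combinatorial part**: `card_filter_add_notMem_box_le` — at most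
  `(∑ᵢ |δᵢ|) M^{n−1}` vectors `ā` of the box `[0, M)ⁿ` leave it under `ā ↦ ā + δ`; and
  **`card_bad_le`** — among the `2 · Mⁿ · |X|` register contents `(t, ā, x̄)`, those whose partner
  `(1 − t, ā ± δ, x̄ ∓ ū)` is not a register content number at most
  `(#{ā ∈ A | ā + δ ∉ A} + #{ā ∈ A | ā − δ ∉ A}) · |X| + |A| · (#{x̄ ∈ X | x̄ − ū ∉ X} + #{x̄ ∈ X | x̄ + ū ∉ X})`
  — the two error terms `n 2^{2n+1}/M` and `O(√n ‖ū‖/R)` of the paper, before they are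
  estimated (Lemma 3.3 bounds `|δᵢ|`, `RegevBallGeometry.lean` bounds the second).

## References

* O. Regev, *Quantum computation and lattice problems*, SIAM J. Comput. 33 (2004) 738–760:
  §3.2 proof of Lemma 3.4 (the map `f`, p. 8), Claims 3.5–3.6 (p. 9), §3.3 proof of Lemma 3.12,
  Claims 3.13–3.14 (pp. 14–15).
-/

noncomputable section

namespace Literature.Algebra.EuclideanLattices

namespace Regev2004

open Module Finset

/-! ### The map `f(t, ā)` and the hidden shift -/

section Map

variable {n : ℕ}

/-- Regev's coefficient vector of `f(t, ā)`: `ā` with `a_{i₀}` replaced by `a_{i₀} p + t m`.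
[cite: Regev2004, Lemma 3.4 (proof, p. 8: the function f)] -/
def twoPointCoeffs (i₀ : Fin n) (p m t : ℤ) (a : Fin n → ℤ) : Fin n → ℤ :=
  Function.update a i₀ (a i₀ * p + t * m)

/-- The coefficient at `i₀`. [folklore] -/
@[simp] theorem twoPointCoeffs_self (i₀ : Fin n) (p m t : ℤ) (a : Fin n → ℤ) :
    twoPointCoeffs i₀ p m t a i₀ = a i₀ * p + t * m := by
  simp [twoPointCoeffs]

/-- The other coefficients. [folklore] -/
@[simp] theorem twoPointCoeffs_of_ne {i₀ i : Fin n} (h : i ≠ i₀) (p m t : ℤ) (a : Fin n → ℤ) :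
    twoPointCoeffs i₀ p m t a i = a i := by
  simp [twoPointCoeffs, h]

/-- The hidden difference of the two-point problem: `δ = ((u_{i₀} − m)/p, u₂, …, uₙ)` (with `i₀`
in place of `1`). [cite: Regev2004, Lemma 3.12 (statement) and Claim 3.13] -/
def hiddenShift (i₀ : Fin n) (p m : ℤ) (u : Fin n → ℤ) : Fin n → ℤ :=
  Function.update u i₀ ((u i₀ - m) / p)

/-- The hidden shift at `i₀`. [folklore] -/
@[simp] theorem hiddenShift_self (i₀ : Fin n) (p m : ℤ) (u : Fin n → ℤ) :
    hiddenShift i₀ p m u i₀ = (u i₀ - m) / p := by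
  simp [hiddenShift]

/-- The hidden shift elsewhere. [folklore] -/
@[simp] theorem hiddenShift_of_ne {i₀ i : Fin n} (h : i ≠ i₀) (p m : ℤ) (u : Fin n → ℤ) :
    hiddenShift i₀ p m u i = u i := by
  simp [hiddenShift, h]

/-- **The partner has coefficients shifted by `u`**: if `p ∣ u_{i₀} − m` then
`c(1, ā + δ) = c(0, ā) + u` ("Notice that `f(1, ā') − f(0, ā) = ū`", p. 9).
[cite: Regev2004, Claim 3.6 (proof, p. 9) and Claim 3.14] -/
theorem twoPointCoeffs_one_add_hiddenShift (i₀ : Fin n) {p m : ℤ} {u : Fin n → ℤ} (hum : p ∣ u i₀ - m)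
    (a : Fin n → ℤ) :
    twoPointCoeffs i₀ p m 1 (a + hiddenShift i₀ p m u) = twoPointCoeffs i₀ p m 0 a + u := by
  funext i
  by_cases hi : i = i₀
  · subst hi
    simp only [twoPointCoeffs_self, Pi.add_apply, hiddenShift_self, one_mul, zero_mul, add_zero]
    rw [add_mul, Int.ediv_mul_cancel hum]
    ring
  · simp [twoPointCoeffs_of_ne hi, hiddenShift_of_ne hi]

/-- The same identity read backwards: `c(0, ā − δ) = c(1, ā) − u`. [cite: Regev2004, Claim 3.6 (proof, p. 9, the case t = 1)] -/
theorem twoPointCoeffs_zero_sub_hiddenShift (i₀ : Fin n) {p m : ℤ} {u : Fin n → ℤ} (hum : p ∣ u i₀ - m)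
    (a : Fin n → ℤ) :
    twoPointCoeffs i₀ p m 0 (a - hiddenShift i₀ p m u) = twoPointCoeffs i₀ p m 1 a - u := by
  have h := twoPointCoeffs_one_add_hiddenShift i₀ hum (a - hiddenShift i₀ p m u)
  rw [sub_add_cancel] at h
  rw [h, add_sub_cancel_right]

/-- **`(t, ā) ↦ c(t, ā)` is injective on `{0,1} × ℤⁿ`** when `0 < m < p`: the coefficient at
`i₀` determines `t` (as `a_{i₀} p + t m mod p ∈ {0, m}`) and then `a_{i₀}`.
[cite: Regev2004, Claim 3.5 (proof, p. 9)] -/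
theorem twoPointCoeffs_injective (i₀ : Fin n) {p m : ℤ} (hm0 : 0 < m) (hmp : m < p)
    {t t' : ℤ} (ht : t = 0 ∨ t = 1) (ht' : t' = 0 ∨ t' = 1) {a a' : Fin n → ℤ}
    (h : twoPointCoeffs i₀ p m t a = twoPointCoeffs i₀ p m t' a') : t = t' ∧ a = a' := by
  have h0 : a i₀ * p + t * m = a' i₀ * p + t' * m := by
    have := congrFun h i₀
    simpa using this
  have hp : 0 < p := hm0.trans hmp
  -- `t = t'`: otherwise `p ∣ m`
  have htt : t = t' := by
    rcases ht with rfl | rfl <;> rcases ht' with rfl | rfl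
    · rfl
    · exfalso
      have e : m = (a i₀ - a' i₀) * p := by linarith
      have hd : p ∣ m := ⟨a i₀ - a' i₀, by rw [e]; ring⟩
      exact absurd (Int.le_of_dvd hm0 hd) (not_le.2 hmp)
    · exfalso
      have e : m = (a' i₀ - a i₀) * p := by linarith
      have hd : p ∣ m := ⟨a' i₀ - a i₀, by rw [e]; ring⟩
      exact absurd (Int.le_of_dvd hm0 hd) (not_le.2 hmp)
    · rfl
  subst htt
  refine ⟨rfl, funext fun i => ?_⟩
  by_cases hi : i = i₀
  · subst hi
    have e : a i * p = a' i * p := by linarith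
    exact mul_right_cancel₀ hp.ne' e
  · have := congrFun h i
    simpa [twoPointCoeffs_of_ne hi] using this

end Map

/-! ### The lattice point `f(t, ā)` of an integer basis -/

section Vec

variable (I : LatticeInstance)

/-- The lattice point `f(t, ā) = ∑ᵢ cᵢ(t, ā) bᵢ ∈ ℤⁿ` (as an integer vector, row convention
`c ᵥ* B`). [cite: Regev2004, Lemma 3.4 (proof, p. 8: the function f)] -/
def twoPointVec (i₀ : Fin I.n) (p m t : ℤ) (a : Fin I.n → ℤ) : Fin I.n → ℤ :=
  Matrix.vecMul (twoPointCoeffs i₀ p m t a) I.basis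

/-- `f(t, ā)` in `ℝⁿ` is the lattice vector with coefficients `c(t, ā)`. [folklore] -/
theorem intVecToEuclidean_twoPointVec (i₀ : Fin I.n) (p m t : ℤ) (a : Fin I.n → ℤ) :
    intVecToEuclidean I.n (twoPointVec I i₀ p m t a) = I.ofCoeffs (twoPointCoeffs i₀ p m t a) := rfl

/-- `f(t, ā)` is a lattice vector. [folklore] -/
theorem twoPointVec_mem_lattice (i₀ : Fin I.n) (p m t : ℤ) (a : Fin I.n → ℤ) :
    intVecToEuclidean I.n (twoPointVec I i₀ p m t a) ∈ I.lattice :=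
  I.ofCoeffs_mem_lattice _

/-- **Partners are measured alike**: `f(1, ā + δ) = f(0, ā) + ū` where `ū = u ᵥ* B` is the
vector with coefficients `u` (`p ∣ u_{i₀} − m`). Hence `f(0, ā) + x̄ = f(1, ā + δ) + (x̄ − ū)`.
[cite: Regev2004, Claim 3.14 (proof, p. 15: f(1−t, ā') − f(t, ā) = ū)] -/
theorem twoPointVec_partner (i₀ : Fin I.n) {p m : ℤ} {u : Fin I.n → ℤ} (hum : p ∣ u i₀ - m)
    (a : Fin I.n → ℤ) :
    twoPointVec I i₀ p m 1 (a + hiddenShift i₀ p m u) = twoPointVec I i₀ p m 0 a + Matrix.vecMul u I.basis := by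
  rw [twoPointVec, twoPointCoeffs_one_add_hiddenShift i₀ hum, Matrix.add_vecMul]
  rfl

/-- The same for `t = 1`: `f(0, ā − δ) = f(1, ā) − ū`. [cite: Regev2004, Claim 3.14 (proof, p. 15)] -/
theorem twoPointVec_partner' (i₀ : Fin I.n) {p m : ℤ} {u : Fin I.n → ℤ} (hum : p ∣ u i₀ - m)
    (a : Fin I.n → ℤ) :
    twoPointVec I i₀ p m 0 (a - hiddenShift i₀ p m u) = twoPointVec I i₀ p m 1 a - Matrix.vecMul u I.basis := by
  rw [twoPointVec, twoPointCoeffs_zero_sub_hiddenShift i₀ hum, Matrix.sub_vecMul]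
  rfl

/-- For a nonsingular basis, `f` is injective on `{0,1} × ℤⁿ` (`0 < m < p`).
[cite: Regev2004, Claim 3.5 (proof, p. 9)] -/
theorem twoPointVec_injective {I : LatticeInstance} (hI : I.IsNonsingular) (i₀ : Fin I.n) {p m : ℤ}
    (hm0 : 0 < m) (hmp : m < p) {t t' : ℤ} (ht : t = 0 ∨ t = 1) (ht' : t' = 0 ∨ t' = 1)
    {a a' : Fin I.n → ℤ} (h : twoPointVec I i₀ p m t a = twoPointVec I i₀ p m t' a') : t = t' ∧ a = a' := by
  refine twoPointCoeffs_injective i₀ hm0 hmp ht ht' ?_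
  have h0 : Matrix.vecMul (twoPointCoeffs i₀ p m t a - twoPointCoeffs i₀ p m t' a') I.basis = 0 := by
    rw [Matrix.sub_vecMul, sub_eq_zero]
    exact h
  exact sub_eq_zero.1 (Matrix.eq_zero_of_vecMul_eq_zero hI h0)

end Vec

/-! ### The `mod p` bookkeeping for `m` coprime to `p` -/

section ModP

variable {E : Type*} [AddCommGroup E] [Module ℝ E] {n : ℕ}

/-- **The `mod p` step of Claims 3.5 / 3.13 for a modulus `p` and a residue `m` coprime to `p`**
(Regev takes `p` prime; only `gcd(m, p) = 1` is used). If `b` is linearly independent,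
`u_{i₀} ≡ m (mod p)` and `f(t', ā') − f(t, ā) = k ū` (as vectors with coefficients `c(t', ā')`,
`c(t, ā)`, `u`), then `k ≡ t' − t (mod p)`. [cite: Regev2004, Claim 3.13 (proof, p. 15)] -/
theorem int_modEq_of_sub_eq_smul_of_isCoprime {b : Fin n → E} (hb : LinearIndependent ℝ b)
    {p m : ℤ} (hm : IsCoprime m p) {u : Fin n → ℤ} {i₀ : Fin n}
    (hu : u i₀ ≡ m [ZMOD p]) {t t' : ℤ} {a a' : Fin n → ℤ} {k : ℤ}
    (h : ∑ i, ((twoPointCoeffs i₀ p m t' a' i : ℤ) : ℝ) • b i -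
        ∑ i, ((twoPointCoeffs i₀ p m t a i : ℤ) : ℝ) • b i = (k : ℝ) • ∑ i, ((u i : ℤ) : ℝ) • b i) :
    k ≡ t' - t [ZMOD p] := by
  set c' : Fin n → ℤ := twoPointCoeffs i₀ p m t' a' with hc'
  set c : Fin n → ℤ := twoPointCoeffs i₀ p m t a with hc
  have hzero : ∑ i, ((c' i - c i - k * u i : ℤ) : ℝ) • b i = 0 := by
    have e : ∑ i, ((c' i - c i - k * u i : ℤ) : ℝ) • b i =
        (∑ i, ((c' i : ℤ) : ℝ) • b i - ∑ i, ((c i : ℤ) : ℝ) • b i) - (k : ℝ) • ∑ i, ((u i : ℤ) : ℝ) • b i := by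
      simp only [Int.cast_sub, Int.cast_mul, sub_smul, mul_smul, Finset.sum_sub_distrib, Finset.smul_sum]
    rw [e, h, sub_self]
  have hcoef := (Fintype.linearIndependent_iff.1 hb) _ hzero i₀
  have hint : c' i₀ - c i₀ - k * u i₀ = 0 := by exact_mod_cast hcoef
  have hi₀ : c' i₀ - c i₀ = (a' i₀ - a i₀) * p + (t' - t) * m := by
    simp only [hc', hc, twoPointCoeffs_self]
    ring
  have hmod : (t' - t) * m ≡ k * m [ZMOD p] := by
    have e1 : (t' - t) * m = k * u i₀ - (a' i₀ - a i₀) * p := by linear_combination hint - hi₀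
    calc (t' - t) * m = k * u i₀ - (a' i₀ - a i₀) * p := e1
      _ ≡ k * u i₀ - 0 [ZMOD p] := Int.ModEq.sub rfl (Int.modEq_zero_iff_dvd.2 (dvd_mul_left _ _))
      _ = k * u i₀ := sub_zero _
      _ ≡ k * m [ZMOD p] := hu.mul_left k
  have hdvd : p ∣ (k - (t' - t)) * m := by
    have := Int.ModEq.dvd hmod
    rwa [← sub_mul] at this
  -- `m` is invertible modulo `p`
  have hk : p ∣ k - (t' - t) := hm.symm.dvd_of_dvd_mul_right hdvd
  exact (Int.modEq_iff_dvd.2 hk).symm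

end ModP

/-! ### Claim 3.13: the fibres of the measurement are two-point sets -/

section Fiber

variable {I : LatticeInstance}

/-- The hypotheses of Claim 3.13 on the data, bundled: a nonsingular basis of dimension `≥ 2`,
the coefficient vector `u` of a shortest nonzero vector `ū`, a modulus `p` and a residue
`0 < m < p` coprime to `p` with `u_{i₀} ≡ m (mod p)`, and a finite point set `X ⊆ ℤⁿ` all of
whose differences are shorter than `λ₂(L)` and than `(p − 1) λ₁(L)` (for the grid points of a
ball of radius `R`: `2R < λ₂` and `2R < (p − 1)‖ū‖`, Regev's `c_unq > 2 c_bal` and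
`p > n^{2+2f}`). [cite: Regev2004, Claim 3.13 (hypotheses, pp. 13–14)] -/
structure FiberHyp (I : LatticeInstance) (i₀ : Fin I.n) (p m : ℤ) (u : Fin I.n → ℤ)
    (X : Finset (Fin I.n → ℤ)) : Prop where
  nonsing : I.IsNonsingular
  two_le : 2 ≤ I.n
  shortest : ‖I.ofCoeffs u‖ = minNorm I.lattice
  ne_zero : u ≠ 0
  m_pos : 0 < m
  m_lt : m < p
  coprime : IsCoprime m p
  modEq : u i₀ ≡ m [ZMOD p]
  diff_lt_two : ∀ x ∈ X, ∀ x' ∈ X, ‖intVecToEuclidean I.n (x - x')‖ < successiveMinimum I.lattice 2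
  diff_lt_p : ∀ x ∈ X, ∀ x' ∈ X, ‖intVecToEuclidean I.n (x - x')‖ < (p - 1) * minNorm I.lattice

variable {i₀ : Fin I.n} {p m : ℤ} {u : Fin I.n → ℤ} {X : Finset (Fin I.n → ℤ)}

/-- Under `FiberHyp`, `p ∣ u_{i₀} − m`. [folklore] -/
theorem FiberHyp.dvd (H : FiberHyp I i₀ p m u X) : p ∣ u i₀ - m :=
  (Int.ModEq.dvd H.modEq.symm)

/-- **The key step of Claims 3.5 / 3.13.** If `(t, ā)` and `(t', ā')` (`t, t' ∈ {0,1}`) are both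
compatible with the measured value `y` (`y − f(t, ā) ∈ X` and `y − f(t', ā') ∈ X`), then
`c(t', ā') − c(t, ā) = k u` with `k ≡ t' − t (mod p)` and `|k| < p − 1`: the difference
`f(t', ā') − f(t, ā)` is a difference of two points of `X`, hence shorter than `λ₂` — so an
integer multiple `k ū` of the shortest vector — and shorter than `(p − 1) λ₁`.
[cite: Regev2004, Claim 3.13 (proof, pp. 14–15)] -/
theorem FiberHyp.exists_k (H : FiberHyp I i₀ p m u X) {y : Fin I.n → ℤ} {t t' : ℤ} {a a' : Fin I.n → ℤ}
    (hx : y - twoPointVec I i₀ p m t a ∈ X) (hx' : y - twoPointVec I i₀ p m t' a' ∈ X) :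
    ∃ k : ℤ, twoPointCoeffs i₀ p m t' a' - twoPointCoeffs i₀ p m t a = k • u ∧
      k ≡ t' - t [ZMOD p] ∧ |k| < p - 1 := by
  have hli : LinearIndependent ℝ I.vec := LatticeInstance.linearIndependent_vec H.nonsing
  set c := twoPointCoeffs i₀ p m t a with hc
  set c' := twoPointCoeffs i₀ p m t' a' with hc'
  -- the difference of the two lattice points is the difference of two points of `X`
  have hdiff : twoPointVec I i₀ p m t' a' - twoPointVec I i₀ p m t a =
      (y - twoPointVec I i₀ p m t a) - (y - twoPointVec I i₀ p m t' a') := by abel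
  have hw : I.ofCoeffs (c' - c) = intVecToEuclidean I.n ((y - twoPointVec I i₀ p m t a) - (y - twoPointVec I i₀ p m t' a')) := by
    rw [← hdiff, map_sub, intVecToEuclidean_twoPointVec, intVecToEuclidean_twoPointVec, ofCoeffs_sub]
  have hwL : I.ofCoeffs (c' - c) ∈ I.lattice := I.ofCoeffs_mem_lattice _
  have hlt2 : ‖I.ofCoeffs (c' - c)‖ < successiveMinimum I.lattice 2 := by
    rw [hw]; exact H.diff_lt_two _ hx _ hx'
  have hltp : ‖I.ofCoeffs (c' - c)‖ < (p - 1) * minNorm I.lattice := by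
    rw [hw]; exact H.diff_lt_p _ hx _ hx'
  -- `ū` is a shortest nonzero vector, so the difference is `k ū`
  have hu0 : I.ofCoeffs u ≠ 0 := by
    intro h0
    have : Matrix.vecMul u I.basis = 0 := intVecToEuclidean_injective I.n (by
      rw [map_zero]; exact h0)
    exact H.ne_zero (Matrix.eq_zero_of_vecMul_eq_zero H.nonsing this)
  have hrank : 2 ≤ finrank ℝ (Submodule.span ℝ (I.lattice : Set (EuclideanSpace ℝ (Fin I.n)))) := by
    rw [LatticeInstance.span_real_lattice_eq_top H.nonsing, finrank_top, finrank_euclideanSpace_fin]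
    exact H.two_le
  obtain ⟨k, hk⟩ := exists_int_smul_of_norm_lt_successiveMinimum_two I.lattice hrank
    (I.ofCoeffs_mem_lattice u) hu0 H.shortest hwL hlt2
  -- compare coefficient vectors
  have hcoef : c' - c = k • u := by
    have h0 : Matrix.vecMul (c' - c - k • u) I.basis = 0 := by
      apply intVecToEuclidean_injective I.n
      rw [Matrix.sub_vecMul, map_sub, Matrix.smul_vecMul, map_zsmul, map_zero, sub_eq_zero]
      exact hk
    exact sub_eq_zero.1 (Matrix.eq_zero_of_vecMul_eq_zero H.nonsing h0)
  refine ⟨k, hcoef, ?_, ?_⟩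
  · -- `k ≡ t' − t (mod p)`
    refine int_modEq_of_sub_eq_smul_of_isCoprime hli H.coprime H.modEq (t := t) (t' := t') (a := a) (a' := a') ?_
    rw [← hc, ← hc']
    have e1 : ∑ i, ((c' i : ℤ) : ℝ) • I.vec i - ∑ i, ((c i : ℤ) : ℝ) • I.vec i = I.ofCoeffs (c' - c) := by
      rw [ofCoeffs_sub, I.ofCoeffs_eq_sum, I.ofCoeffs_eq_sum]
      simp only [Int.cast_smul_eq_zsmul]
    have e2 : (k : ℝ) • ∑ i, ((u i : ℤ) : ℝ) • I.vec i = k • I.ofCoeffs u := by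
      rw [I.ofCoeffs_eq_sum, Int.cast_smul_eq_zsmul]
      simp only [Int.cast_smul_eq_zsmul]
    rw [e1, e2, hk]
  · -- `|k| < p − 1` from `‖k ū‖ < (p − 1) λ₁` and `‖ū‖ = λ₁ > 0`
    have hpos : 0 < minNorm I.lattice := by rw [← H.shortest]; exact norm_pos_iff.2 hu0
    have hnorm : ‖I.ofCoeffs (c' - c)‖ = |(k : ℝ)| * minNorm I.lattice := by
      rw [hk, ← Int.cast_smul_eq_zsmul ℝ k, norm_smul, Real.norm_eq_abs, H.shortest]
    rw [hnorm] at hltp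
    have : |(k : ℝ)| < p - 1 := lt_of_mul_lt_mul_right hltp hpos.le
    exact_mod_cast this

/-- **Claim 3.13, first part: at most one element of each type.** For every `y` and each
`t ∈ {0,1}` there is at most one `ā` with `y − f(t, ā) ∈ X`.
[cite: Regev2004, Claim 3.13 (first part)] -/
theorem FiberHyp.fiber_unique (H : FiberHyp I i₀ p m u X) {y : Fin I.n → ℤ} {t : ℤ} (ht : t = 0 ∨ t = 1)
    {a a' : Fin I.n → ℤ} (hx : y - twoPointVec I i₀ p m t a ∈ X) (hx' : y - twoPointVec I i₀ p m t a' ∈ X) :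
    a = a' := by
  obtain ⟨k, hk, hkmod, hkabs⟩ := H.exists_k hx hx'
  rw [sub_self] at hkmod
  have hk0 : k = 0 :=
    Int.eq_zero_of_abs_lt_dvd (Int.modEq_zero_iff_dvd.1 hkmod) (by omega)
  rw [hk0, zero_smul, sub_eq_zero] at hk
  exact ((twoPointCoeffs_injective i₀ H.m_pos H.m_lt ht ht hk).2).symm

/-- **Claim 3.13, second part: the two types differ by the hidden shift.** If `y − f(0, ā) ∈ X`
and `y − f(1, ā') ∈ X` then `ā' = ā + δ`. [cite: Regev2004, Claim 3.13 (second part)] -/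
theorem FiberHyp.fiber_pair (H : FiberHyp I i₀ p m u X) {y : Fin I.n → ℤ} {a a' : Fin I.n → ℤ}
    (hx : y - twoPointVec I i₀ p m 0 a ∈ X) (hx' : y - twoPointVec I i₀ p m 1 a' ∈ X) :
    a' = a + hiddenShift i₀ p m u := by
  obtain ⟨k, hk, hkmod, hkabs⟩ := H.exists_k hx hx'
  rw [sub_zero] at hkmod
  have hk1 : k = 1 := by
    have hp0 : 0 ≤ p := by have := H.m_pos; have := H.m_lt; omega
    lift p to ℕ using hp0 with q
    exact eq_one_of_modEq_one_of_abs_lt hkmod (by exact_mod_cast hkabs)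
  rw [hk1, one_smul] at hk
  -- `c(1, ā') = c(0, ā) + u = c(1, ā + δ)`, and `c(1, ·)` is injective
  have h1 : twoPointCoeffs i₀ p m 1 a' = twoPointCoeffs i₀ p m 1 (a + hiddenShift i₀ p m u) := by
    rw [twoPointCoeffs_one_add_hiddenShift i₀ H.dvd, ← hk, add_sub_cancel]
  exact (twoPointCoeffs_injective i₀ H.m_pos H.m_lt (Or.inr rfl) (Or.inr rfl) h1).2

/-- **The fibre of `y` through a register content, type `0`.** If `y = f(0, ā) + x̄` with
`x̄ ∈ X`, then the type-`1` elements compatible with `y` are exactly `(1, ā + δ)` when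
`x̄ − ū ∈ X`, and none otherwise: `y − f(1, ā') ∈ X ↔ ā' = ā + δ ∧ x̄ − ū ∈ X`.
[cite: Regev2004, Claims 3.13–3.14] -/
theorem FiberHyp.mem_fiber_one_iff (H : FiberHyp I i₀ p m u X) {a x : Fin I.n → ℤ} (hxX : x ∈ X)
    (a' : Fin I.n → ℤ) :
    (twoPointVec I i₀ p m 0 a + x) - twoPointVec I i₀ p m 1 a' ∈ X ↔
      a' = a + hiddenShift i₀ p m u ∧ x - Matrix.vecMul u I.basis ∈ X := by
  have hpart := twoPointVec_partner I i₀ H.dvd a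
  have e : twoPointVec I i₀ p m 0 a + x - (twoPointVec I i₀ p m 0 a + Matrix.vecMul u I.basis) =
      x - Matrix.vecMul u I.basis := by abel
  constructor
  · intro h
    have h0 : (twoPointVec I i₀ p m 0 a + x) - twoPointVec I i₀ p m 0 a ∈ X := by
      rwa [add_sub_cancel_left]
    have ha' := H.fiber_pair h0 h
    refine ⟨ha', ?_⟩
    rw [ha', hpart, e] at h
    exact h
  · rintro ⟨rfl, hxu⟩
    rwa [hpart, e]

/-- **The fibre of `y` through a register content, type `1`.** If `y = f(1, ā) + x̄` with
`x̄ ∈ X`, then `y − f(0, ā') ∈ X ↔ ā' = ā − δ ∧ x̄ + ū ∈ X`. [cite: Regev2004, Claims 3.13–3.14] -/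
theorem FiberHyp.mem_fiber_zero_iff (H : FiberHyp I i₀ p m u X) {a x : Fin I.n → ℤ} (hxX : x ∈ X)
    (a' : Fin I.n → ℤ) :
    (twoPointVec I i₀ p m 1 a + x) - twoPointVec I i₀ p m 0 a' ∈ X ↔
      a' = a - hiddenShift i₀ p m u ∧ x + Matrix.vecMul u I.basis ∈ X := by
  have hpart := twoPointVec_partner' I i₀ H.dvd a
  have e : twoPointVec I i₀ p m 1 a + x - (twoPointVec I i₀ p m 1 a - Matrix.vecMul u I.basis) =
      x + Matrix.vecMul u I.basis := by abel
  constructor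
  · intro h
    have h1 : (twoPointVec I i₀ p m 1 a + x) - twoPointVec I i₀ p m 1 a ∈ X := by
      rwa [add_sub_cancel_left]
    have ha := H.fiber_pair h h1
    have ha' : a' = a - hiddenShift i₀ p m u := by rw [ha, add_sub_cancel_right]
    refine ⟨ha', ?_⟩
    rw [ha', hpart, e] at h
    exact h
  · rintro ⟨rfl, hxu⟩
    rwa [hpart, e]

/-- **Same type, same content**: if `y = f(t, ā) + x̄` with `x̄ ∈ X` then the only type-`t`
element compatible with `y` is `ā` itself. [cite: Regev2004, Claim 3.13 (first part)] -/
theorem FiberHyp.mem_fiber_same_iff (H : FiberHyp I i₀ p m u X) {t : ℤ} (ht : t = 0 ∨ t = 1)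
    {a x : Fin I.n → ℤ} (hxX : x ∈ X) (a' : Fin I.n → ℤ) :
    (twoPointVec I i₀ p m t a + x) - twoPointVec I i₀ p m t a' ∈ X ↔ a' = a := by
  constructor
  · intro h
    have h0 : (twoPointVec I i₀ p m t a + x) - twoPointVec I i₀ p m t a ∈ X := by
      rwa [add_sub_cancel_left]
    exact (H.fiber_unique ht h0 h).symm
  · rintro rfl
    rwa [add_sub_cancel_left]

end Fiber

/-! ### Claim 3.14, combinatorial part: register contents without a partner -/

section Count

variable {n : ℕ}

/-- The box `A = {0, …, M − 1}ⁿ` of coefficient vectors. [cite: Regev2004, Lemma 3.4 (proof, p. 8: the set A)] -/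
def box (n M : ℕ) : Finset (Fin n → ℤ) := Fintype.piFinset fun _ : Fin n => Finset.Ico (0 : ℤ) M

/-- Membership in the box. [folklore] -/
theorem mem_box_iff {M : ℕ} (a : Fin n → ℤ) : a ∈ box n M ↔ ∀ i, 0 ≤ a i ∧ a i < M := by
  simp [box, Fintype.mem_piFinset]

/-- The box has `Mⁿ` elements. [folklore] -/
theorem card_box (n M : ℕ) : (box n M).card = M ^ n := by
  simp [box, Fintype.card_piFinset]

/-- In one coordinate, at most `|d|` residues `v ∈ [0, M)` have `v + d ∉ [0, M)`. [folklore] -/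
theorem card_filter_Ico_add_notMem_le (M : ℕ) (d : ℤ) :
    ((Finset.Ico (0 : ℤ) M).filter fun v => v + d ∉ Finset.Ico (0 : ℤ) M).card ≤ d.natAbs := by
  calc ((Finset.Ico (0 : ℤ) M).filter fun v => v + d ∉ Finset.Ico (0 : ℤ) M).card
      ≤ (Finset.Ico ((M : ℤ) - d) M ∪ Finset.Ico 0 (-d)).card := by
        refine Finset.card_le_card fun v hv => ?_
        simp only [Finset.mem_filter, Finset.mem_Ico, not_and, not_lt] at hv
        simp only [Finset.mem_union, Finset.mem_Ico]
        obtain ⟨⟨h0, hM⟩, h⟩ := hv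
        by_cases hd : 0 ≤ v + d
        · have := h hd
          left; omega
        · right; omega
    _ ≤ (Finset.Ico ((M : ℤ) - d) M).card + (Finset.Ico 0 (-d)).card := Finset.card_union_le _ _
    _ ≤ d.natAbs := by
        rw [Int.card_Ico, Int.card_Ico]
        omega

/-- **At most `(∑ᵢ |δᵢ|) · M^{n−1}` vectors of the box leave it under translation by `δ`**
("unless there exists an `i` for which `aᵢ < 2^{2n}` or `aᵢ > M − 2^{2n}`, `ā'` is guaranteed to
be in `A`", union bound over the coordinates). [cite: Regev2004, Claim 3.14 (proof, first paragraph, p. 15)] -/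
theorem card_filter_add_notMem_box_le (M : ℕ) (δ : Fin n → ℤ) :
    ((box n M).filter fun a => a + δ ∉ box n M).card ≤ (∑ i, (δ i).natAbs) * M ^ (n - 1) := by
  classical
  -- union bound over the coordinate that leaves `[0, M)`
  set bad : Fin n → Finset ℤ := fun i => (Finset.Ico (0 : ℤ) M).filter fun v => v + δ i ∉ Finset.Ico (0 : ℤ) M
    with hbad
  set Bi : Fin n → Finset (Fin n → ℤ) := fun i =>
    Fintype.piFinset (Function.update (fun _ : Fin n => Finset.Ico (0 : ℤ) M) i (bad i)) with hBi
  have hsub : ((box n M).filter fun a => a + δ ∉ box n M) ⊆ Finset.univ.biUnion Bi := by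
    intro a ha
    simp only [Finset.mem_filter, mem_box_iff, not_forall] at ha
    obtain ⟨hA, i, hi⟩ := ha
    simp only [Finset.mem_biUnion, Finset.mem_univ, true_and]
    refine ⟨i, ?_⟩
    simp only [hBi, Fintype.mem_piFinset]
    intro j
    by_cases hj : j = i
    · subst hj
      rw [Function.update_self]
      simp only [hbad, Finset.mem_filter, Finset.mem_Ico]
      exact ⟨hA j, by simpa using hi⟩
    · rw [Function.update_of_ne hj, Finset.mem_Ico]
      exact hA j
  have hcard : ∀ i, (Bi i).card ≤ (δ i).natAbs * M ^ (n - 1) := by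
    intro i
    simp only [hBi, Fintype.card_piFinset]
    rw [← Finset.mul_prod_erase Finset.univ _ (Finset.mem_univ i), Function.update_self]
    have e : ∏ j ∈ Finset.univ.erase i, (Function.update (fun _ : Fin n => Finset.Ico (0 : ℤ) M) i (bad i) j).card =
        M ^ (n - 1) := by
      rw [Finset.prod_congr rfl fun j hj => by rw [Function.update_of_ne (Finset.ne_of_mem_erase hj)],
        Finset.prod_const, Finset.card_erase_of_mem (Finset.mem_univ i), Finset.card_univ, Fintype.card_fin]
      simp
    rw [e]
    exact Nat.mul_le_mul_right _ (card_filter_Ico_add_notMem_le M (δ i))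
  calc ((box n M).filter fun a => a + δ ∉ box n M).card ≤ (Finset.univ.biUnion Bi).card := Finset.card_le_card hsub
    _ ≤ ∑ i, (Bi i).card := Finset.card_biUnion_le
    _ ≤ ∑ i, (δ i).natAbs * M ^ (n - 1) := Finset.sum_le_sum fun i _ => hcard i
    _ = (∑ i, (δ i).natAbs) * M ^ (n - 1) := by rw [Finset.sum_mul]

/-- Translation by `−δ` leaves the box as rarely. [cite: Regev2004, Claim 3.14 (proof, p. 15)] -/
theorem card_filter_sub_notMem_box_le (M : ℕ) (δ : Fin n → ℤ) :
    ((box n M).filter fun a => a - δ ∉ box n M).card ≤ (∑ i, (δ i).natAbs) * M ^ (n - 1) := by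
  have h := card_filter_add_notMem_box_le M (-δ)
  simp only [Pi.neg_apply, Int.natAbs_neg] at h
  simpa [sub_eq_add_neg] using h

variable (A X : Finset (Fin n → ℤ)) (δ uv : Fin n → ℤ)

/-- The partner of a register content: `(0, ā, x̄) ↦ (1, ā + δ, x̄ − ū)` and
`(1, ā, x̄) ↦ (0, ā − δ, x̄ + ū)` (an involution). [cite: Regev2004, Claim 3.14 (the vector ā' and the shifted point)] -/
def partner (c : Bool × (Fin n → ℤ) × (Fin n → ℤ)) : Bool × (Fin n → ℤ) × (Fin n → ℤ) :=
  match c with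
  | (false, a, x) => (true, a + δ, x - uv)
  | (true, a, x) => (false, a - δ, x + uv)

/-- `partner` is an involution. [folklore] -/
theorem partner_partner (c : Bool × (Fin n → ℤ) × (Fin n → ℤ)) : partner δ uv (partner δ uv c) = c := by
  obtain ⟨t, a, x⟩ := c
  cases t <;> simp [partner]

/-- The register contents: `{0,1} × A × X`. [cite: Regev2004, Lemma 3.12 (proof, p. 14: the state ∑ |t, ā, x̄⟩)] -/
def contents : Finset (Bool × (Fin n → ℤ) × (Fin n → ℤ)) := Finset.univ ×ˢ (A ×ˢ X)

/-- Membership in `contents`. [folklore] -/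
theorem mem_contents_iff (c : Bool × (Fin n → ℤ) × (Fin n → ℤ)) :
    c ∈ contents A X ↔ c.2.1 ∈ A ∧ c.2.2 ∈ X := by
  simp [contents]

/-- `contents` has `2 |A| |X|` elements. [folklore] -/
theorem card_contents : (contents A X).card = 2 * A.card * X.card := by
  simp [contents, Finset.card_product, mul_assoc]

/-- **Claim 3.14, combinatorial part.** The register contents whose partner is not a register
content are few: at most
`(#{ā ∈ A | ā + δ ∉ A} + #{ā ∈ A | ā − δ ∉ A}) · |X| + |A| · (#{x̄ ∈ X | x̄ − ū ∉ X} + #{x̄ ∈ X | x̄ + ū ∉ X})`.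
(The first term is Regev's `n 2^{2n+1}/M` after `card_filter_add_notMem_box_le` and Lemma 3.3; the
second is his `O(1/(c_bal n^{2f}))` after Cor. 3.9.) [cite: Regev2004, Claim 3.14 (proof, p. 15: the sum of the two error probabilities)] -/
theorem card_filter_partner_notMem_le :
    ((contents A X).filter fun c => partner δ uv c ∉ contents A X).card ≤
      ((A.filter fun a => a + δ ∉ A).card + (A.filter fun a => a - δ ∉ A).card) * X.card +
        A.card * ((X.filter fun x => x - uv ∉ X).card + (X.filter fun x => x + uv ∉ X).card) := by
  classical
  set Ap := A.filter fun a => a + δ ∉ A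
  set Am := A.filter fun a => a - δ ∉ A
  set Xm := X.filter fun x => x - uv ∉ X
  set Xp := X.filter fun x => x + uv ∉ X
  set S1 : Finset (Bool × (Fin n → ℤ) × (Fin n → ℤ)) := {false} ×ˢ (Ap ×ˢ X)
  set S2 : Finset (Bool × (Fin n → ℤ) × (Fin n → ℤ)) := {false} ×ˢ (A ×ˢ Xm)
  set S3 : Finset (Bool × (Fin n → ℤ) × (Fin n → ℤ)) := {true} ×ˢ (Am ×ˢ X)
  set S4 : Finset (Bool × (Fin n → ℤ) × (Fin n → ℤ)) := {true} ×ˢ (A ×ˢ Xp)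
  have hsub : ((contents A X).filter fun c => partner δ uv c ∉ contents A X) ⊆ (S1 ∪ S2) ∪ (S3 ∪ S4) := by
    rintro ⟨t, a, x⟩ hc
    simp only [Finset.mem_filter, mem_contents_iff] at hc
    obtain ⟨⟨haA, hxX⟩, hbad⟩ := hc
    cases t
    · simp only [partner, not_and_or] at hbad
      simp only [Finset.mem_union]
      rcases hbad with h | h
      · exact Or.inl (Or.inl (by simp [S1, Ap, haA, hxX, h]))
      · exact Or.inl (Or.inr (by simp [S2, Xm, haA, hxX, h]))
    · simp only [partner, not_and_or] at hbad
      simp only [Finset.mem_union]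
      rcases hbad with h | h
      · exact Or.inr (Or.inl (by simp [S3, Am, haA, hxX, h]))
      · exact Or.inr (Or.inr (by simp [S4, Xp, haA, hxX, h]))
  calc ((contents A X).filter fun c => partner δ uv c ∉ contents A X).card
      ≤ ((S1 ∪ S2) ∪ (S3 ∪ S4)).card := Finset.card_le_card hsub
    _ ≤ (S1.card + S2.card) + (S3.card + S4.card) :=
        (Finset.card_union_le _ _).trans (Nat.add_le_add (Finset.card_union_le _ _) (Finset.card_union_le _ _))
    _ = (Ap.card + Am.card) * X.card + A.card * (Xm.card + Xp.card) := by
        simp only [S1, S2, S3, S4, Finset.card_product, Finset.card_singleton, one_mul]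
        ring

/-- The complementary count: **at least `2|A||X| − (bad)` register contents have a partner**.
[cite: Regev2004, Claim 3.14] -/
theorem card_filter_partner_mem_ge :
    2 * A.card * X.card ≤ ((contents A X).filter fun c => partner δ uv c ∈ contents A X).card +
      (((A.filter fun a => a + δ ∉ A).card + (A.filter fun a => a - δ ∉ A).card) * X.card +
        A.card * ((X.filter fun x => x - uv ∉ X).card + (X.filter fun x => x + uv ∉ X).card)) := by
  classical
  have h := Finset.card_filter_add_card_filter_not (s := contents A X) (fun c => partner δ uv c ∈ contents A X)
  rw [card_contents] at h
  have h2 := card_filter_partner_notMem_le A X δ uv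
  omega

end Count

end Regev2004

end Literature.Algebra.EuclideanLattices

end
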